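import Mathlib
import Literature.Probability.Percolation.PercolationProofs
import Literature.Probability.Percolation.StarTriangleMoves
import Literature.Probability.LatticeModels.ProdBernoulliIndependence
import HarnessLib

/-! # Crux `PercNearOneGluing.AdditiveGluing` (stmt-CriticalPhenomena-4576), line `subuniform-dead-pocket-maximum` —
# one-bond decomposition of product Bernoulli probabilities (helper for the edge-interpolation reduction of `stub_goodStep`)

`μ_w(S) = (1 − w e) · μ_{w[e↦0]}(S) + (w e) · μ_{w[e↦1]}(S)` for every event `S` and pair `e`
(`stub_oneBondDecomp_k15`, registered helper stub of the crux item): closed side via `prodBernoulli_map_sdiff_singleton` (tree), open side via the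
pushforward of `μ_w` under `ω ↦ insert e ω`, which is `μ_{w[e↦1]}` (`goodStepEI_prodBernoulli_map_insert`,
Mathlib's `Measure.infinitePi_map_pi`).  Used by `PercNearOneGluingAdditiveGluingGoodStepOfTwoBlock.lean`:
every term of the GOOD functional is affine in the weight of a low pair at the observer.  No new definitions. -/

namespace Summit.CriticalPhenomena.PercolationContinuityZ3.Theorems

open MeasureTheory Set
open Literature.Probability.LatticeModels (prodBernoulli)
open Literature.Probability.Percolation (BondConfig DeterminedBy determinedBy_iff)

noncomputable section
open Classical

/-! ### One-bond decomposition of product Bernoulli probabilities -/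

section OneBond

variable {ι : Type*}

/-- **Opening one coordinate**: the image of `P_p` under `ω ↦ insert i₀ ω` is `P_{p[i₀ ↦ 1]}`
(companion of `prodBernoulli_map_sdiff_singleton`; Mathlib's `Measure.infinitePi_map_pi` with the
coordinate map `x ↦ x ∨ i = i₀`). [folklore] -/
theorem goodStepEI_prodBernoulli_map_insert [DecidableEq ι] (p : ι → unitInterval) (i₀ : ι) :
    (prodBernoulli p).map (fun ω : Set ι => insert i₀ ω) = prodBernoulli (Function.update p i₀ 1) := by
  set μ : (ι → unitInterval) → ι → Measure Prop := fun r i =>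
    unitInterval.toNNReal (r i) • Measure.dirac True +
      unitInterval.toNNReal (unitInterval.symm (r i)) • Measure.dirac False with hμ
  haveI hprob : ∀ r i, IsProbabilityMeasure (μ r i) := fun r i => by
    simp only [hμ]; infer_instance
  have h1 : ∀ r, prodBernoulli r = (Measure.infinitePi (μ r)).map (fun q : ι → Prop => {i | q i}) :=
    fun r => Literature.Probability.LatticeModels.prodBernoulli_eq_map r
  have hf : ∀ i : ι, Measurable (fun x : Prop => x ∨ i = i₀) := fun i => measurable_from_top
  have hcomp : (fun ω : Set ι => insert i₀ ω) ∘ (fun q : ι → Prop => {i | q i}) =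
      (fun q : ι → Prop => {i | q i}) ∘ (fun (q : ι → Prop) (i : ι) => q i ∨ i = i₀) := by
    funext q
    ext i
    simp only [Function.comp_apply, Set.mem_insert_iff, Set.mem_setOf_eq]
    exact or_comm
  have hg : Measurable (fun (q : ι → Prop) (i : ι) => q i ∨ i = i₀) :=
    measurable_pi_lambda _ fun i => (hf i).comp (measurable_pi_apply i)
  -- `ω ↦ insert i₀ ω` is measurable (as `NonProliferation.StubLedger.measurable_insert`, kept local here)
  have hmi : Measurable fun ω : Set ι => insert i₀ ω := by
    refine measurable_set_iff.2 fun i => ?_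
    simp only [Set.mem_insert_iff]
    exact measurable_const.or (measurable_set_mem i)
  rw [h1, h1, Measure.map_map hmi measurable_setOf, hcomp,
    ← Measure.map_map measurable_setOf hg, Measure.infinitePi_map_pi _ hf]
  have hfun : (fun i => Measure.map (fun x : Prop => x ∨ i = i₀) (μ p i)) =
      μ (Function.update p i₀ 1) := by
    funext i
    by_cases hi : i = i₀
    · subst hi
      have hc : (fun x : Prop => x ∨ i = i) = fun _ => True := by
        funext x; exact propext ⟨fun _ => trivial, fun _ => Or.inr rfl⟩
      rw [hc, Measure.map_const, measure_univ, one_smul]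
      simp [hμ]
    · have hid : (fun x : Prop => x ∨ i = i₀) = id := by
        funext x; exact propext ⟨fun h => h.elim id fun h' => absurd h' hi, fun h => Or.inl h⟩
      rw [hid, Measure.map_id]
      simp [hμ, Function.update_of_ne hi]
  congr 1
  convert rfl using 2
  exact hfun.symm

end OneBond

variable {n : ℕ}

/-- **One-bond decomposition, open side**: `P_w(S ∩ {e open}) = (w e) · P_{w[e↦1]}(S)`.
[folklore] -/
theorem goodStepEI_real_inter_open_eq (w : Sym2 (Fin n) → unitInterval) (e : Sym2 (Fin n))
    (S : Set (BondConfig (Fin n))) :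
    (prodBernoulli w).real (S ∩ {ω | e ∈ ω}) =
      (w e : ℝ) * (prodBernoulli (Function.update w e 1)).real S := by
  have hmeas : Measurable fun ω : BondConfig (Fin n) => insert e ω := by
    refine measurable_set_iff.2 fun i => ?_
    simp only [Set.mem_insert_iff]
    exact measurable_const.or (measurable_set_mem i)
  have hset : S ∩ {ω : BondConfig (Fin n) | e ∈ ω} =
      {ω | e ∈ ω} ∩ ((fun ω : BondConfig (Fin n) => insert e ω) ⁻¹' S) := by
    ext ω
    simp only [mem_inter_iff, mem_setOf_eq, mem_preimage]
    constructor
    · rintro ⟨hS, he⟩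
      exact ⟨he, by rwa [Set.insert_eq_of_mem he]⟩
    · rintro ⟨he, hS⟩
      exact ⟨by rwa [Set.insert_eq_of_mem he] at hS, he⟩
  have hA : DeterminedBy {ω : BondConfig (Fin n) | e ∈ ω} (↑({e} : Finset (Sym2 (Fin n))) : Set _) := by
    rw [determinedBy_iff]
    intro ω ω' h
    have h1 := Set.ext_iff.1 h e
    simp only [Finset.coe_singleton, mem_inter_iff, mem_singleton_iff, and_true] at h1
    simp only [mem_setOf_eq, h1]
  have hB : DeterminedBy ((fun ω : BondConfig (Fin n) => insert e ω) ⁻¹' S)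
      (↑({e} : Finset (Sym2 (Fin n))) : Set _)ᶜ := by
    rw [determinedBy_iff]
    intro ω ω' h
    simp only [mem_preimage]
    have h2 : insert e ω = insert e ω' := by
      ext x
      have hx := Set.ext_iff.1 h x
      simp only [Finset.coe_singleton, mem_inter_iff, mem_compl_iff, mem_singleton_iff] at hx
      simp only [mem_insert_iff]
      by_cases hxe : x = e
      · simp only [hxe, true_or]
      · exact ⟨fun h' => Or.inr (hx.1 ⟨h'.resolve_left hxe, hxe⟩).1,
          fun h' => Or.inr (hx.2 ⟨h'.resolve_left hxe, hxe⟩).1⟩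
    rw [h2]
  rw [hset, Literature.Probability.LatticeModels.prodBernoulli_real_inter_of_determinedBy w {e} hA hB
      (Set.toFinite _).measurableSet (Set.toFinite _).measurableSet,
    Literature.Probability.LatticeModels.prodBernoulli_real_setOf_mem,
    ← map_measureReal_apply hmeas (Set.toFinite _).measurableSet, goodStepEI_prodBernoulli_map_insert]

/-- **One-bond decomposition, closed side**: `P_w(S ∩ {e closed}) = (1 − w e) · P_{w[e↦0]}(S)`
(as in `Theorems/AdditiveGluing/Negative/EdgeDeletion.lean`, `real_inter_closed_eq`; restated here to
keep the imports of this helper inside `Literature`). [folklore] -/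
theorem goodStepEI_real_inter_closed_eq (w : Sym2 (Fin n) → unitInterval) (e : Sym2 (Fin n))
    (S : Set (BondConfig (Fin n))) :
    (prodBernoulli w).real (S ∩ {ω | e ∉ ω}) =
      (1 - (w e : ℝ)) * (prodBernoulli (Function.update w e 0)).real S := by
  have hmeas : Measurable fun ω : BondConfig (Fin n) => ω \ {e} :=
    Literature.Probability.Percolation.StarTriangle.measurable_sdiff_const _
  have hset : S ∩ {ω : BondConfig (Fin n) | e ∉ ω} =
      {ω | e ∉ ω} ∩ ((fun ω : BondConfig (Fin n) => ω \ {e}) ⁻¹' S) := by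
    ext ω
    simp only [mem_inter_iff, mem_setOf_eq, mem_preimage]
    constructor
    · rintro ⟨hS, he⟩
      exact ⟨he, by rwa [Set.sdiff_singleton_eq_self he]⟩
    · rintro ⟨he, hS⟩
      exact ⟨by rwa [Set.sdiff_singleton_eq_self he] at hS, he⟩
  have hA : DeterminedBy {ω : BondConfig (Fin n) | e ∉ ω} (↑({e} : Finset (Sym2 (Fin n))) : Set _) := by
    rw [determinedBy_iff]
    intro ω ω' h
    have h1 := Set.ext_iff.1 h e
    simp only [Finset.coe_singleton, mem_inter_iff, mem_singleton_iff, and_true] at h1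
    simp only [mem_setOf_eq, h1]
  have hB : DeterminedBy ((fun ω : BondConfig (Fin n) => ω \ {e}) ⁻¹' S)
      (↑({e} : Finset (Sym2 (Fin n))) : Set _)ᶜ := by
    rw [determinedBy_iff]
    intro ω ω' h
    simp only [mem_preimage]
    have h2 : ω \ {e} = ω' \ {e} := by
      ext x
      have hx := Set.ext_iff.1 h x
      simp only [Finset.coe_singleton, mem_inter_iff, mem_compl_iff, mem_singleton_iff] at hx
      simp only [mem_sdiff, mem_singleton_iff]
      exact hx
    rw [h2]
  rw [hset, Literature.Probability.LatticeModels.prodBernoulli_real_inter_of_determinedBy w {e} hA hB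
      (Set.toFinite _).measurableSet (Set.toFinite _).measurableSet,
    Literature.Probability.LatticeModels.prodBernoulli_real_setOf_notMem,
    ← map_measureReal_apply hmeas (Set.toFinite _).measurableSet,
    Literature.Probability.Percolation.StarTriangle.prodBernoulli_map_sdiff_singleton]

/-- **One-bond decomposition** (registered helper stub `stub_oneBondDecomp_k15` of crux
stmt-CriticalPhenomena-4576): `P_w(S) = (1 − w e) P_{w[e↦0]}(S) + (w e) P_{w[e↦1]}(S)` — every
probability is affine in the weight of a single pair. [folklore] -/
theorem stub_oneBondDecomp_k15 :
    ∀ (n : ℕ) (w : Sym2 (Fin n) → unitInterval) (e : Sym2 (Fin n)) (S : Set (BondConfig (Fin n))),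
      (prodBernoulli w).real S =
        (1 - (w e : ℝ)) * (prodBernoulli (Function.update w e 0)).real S +
          (w e : ℝ) * (prodBernoulli (Function.update w e 1)).real S := by
  intro n w e S
  have hU : S = (S ∩ {ω | e ∉ ω}) ∪ (S ∩ {ω | e ∈ ω}) := by
    ext ω
    simp only [mem_union, mem_inter_iff, mem_setOf_eq]
    tauto
  have hD : Disjoint (S ∩ {ω : BondConfig (Fin n) | e ∉ ω}) (S ∩ {ω | e ∈ ω}) := by
    rw [Set.disjoint_left]
    rintro ω ⟨-, h1⟩ ⟨-, h2⟩
    exact h1 h2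
  conv_lhs => rw [hU]
  rw [measureReal_union hD (Set.toFinite _).measurableSet, goodStepEI_real_inter_closed_eq,
    goodStepEI_real_inter_open_eq]

end

end Summit.CriticalPhenomena.PercolationContinuityZ3.Theorems
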